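import Summits.QuantumFields.YangMills.Theorems.DiagonalMirrorRPRWilsonDiagonalModelBlockAtoms
import Summits.QuantumFields.YangMills.Theorems.DiagonalMirrorRPRWilsonDiagonalModelOpenBlockKernel

/-!
# Crux `WeakCouplingHypercubicLimitRP` (stmt-QuantumFields-27398) / aside `DiagonalMirrorRPR` (⟨10604⟩), door B, construction F1_diag —
# PAIRING LAYER, step P3e: the inserted lifted chain as an integral over the three ATOMS (structural splitting of `(μ̃ ⊗ halfHaar)^{⊗N}`)

Helper file (`--supports stmt-QuantumFields-27398 --as helper`) of `hand-10604-wilsonDiagModel-3` (director-ym g23, R695/R701-ym, O4 WORD 30: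
step P3 of hand-1's ROADMAP-F1diag v4 §1⅞ / hand-2's addendum v5); it closes nothing by itself.

* `finSplit_symm_apply`, `piFinSuccAbove_zero_symm_apply` — the inverses of the tree's splitting `Fin (a+b) ≃ Fin a ⊕ Fin b` and of Mathlib's
  `piFinSuccAbove … 0` are `Fin.append` and `Fin.cons`;
* `exists_atomSplit` — the measure-preserving equivalence
  `(Fin N → 𝔜, ν^{⊗N}) ≃ (𝔜 × 𝔜^{e}) × ((𝔜 × 𝔜^{n+1}) × (𝔜 × 𝔜^{e}))` whose inverse sends `((z_u, L), ((z_d, W), (z_0, R)))` to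
  `atomApp (z_0 ∷ R) (z_d ∷ W) (z_u ∷ L)` (`N = (e+1)+(n+2)+(e+1)`, the three atoms of `…BlockAtoms`, LEFT atom outermost);
* ★ `integral_insertedChain_eq_integral_atoms` — the inserted link-kernel chain over `(μ̃ ⊗ halfHaar)^{⊗N}` equals the integral, over the
  product of the three peeled atoms, of `Qb(z_d·₁, W, z_u) · (Lb(z_u·₁, L, z_0) · Pb(z_0·₁, R, z_d))` with `Pb/Qb/Lb` the dressed block weights
  `blockFun (readR I) / blockFun 1 / blockFun (readL I)` (`insertedChain_atomApp`), together with the measurability and bounds of this integrand.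

HONEST FRAMING: bookkeeping only; `wilsonDiagonalModel` is NOT landed here; no letter is proved; D1, ⟨27398⟩, S6i, ⟨10604⟩ are OPEN; nothing here
bears on the summit; the Yang–Mills mass gap is NOT proved here or anywhere in the tree.  No definition, no instance, no notation (the scoped
`Fin.NatCast` coercion is opened to write layer positions).
-/

set_option autoImplicit false

noncomputable section

open scoped BigOperators ENNReal
open MeasureTheory Function Filter Fin.NatCast
open Literature.MathematicalPhysics.QuantumLattice Literature.MathematicalPhysics.QuantumFieldTheory
open Summit.QuantumFields.YangMills.Cruxes.DiagonalMirrorRPR.ParityBridgeColdTraces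

namespace Summit.QuantumFields.YangMills.Cruxes.DiagonalMirrorRPR.SignTwistedDiagonalTrace.WilsonDiagonal

/-! ## §1 Inverses of the structural equivalences -/

section Structural

variable {Y : Type*} [MeasurableSpace Y]

/-- The inverse of the splitting `Fin (a + b) → Y ≃ (Fin a → Y) × (Fin b → Y)` is `Fin.append`. -/
theorem finSplit_symm_apply (a b : ℕ) (x : Fin a → Y) (y : Fin b → Y) :
    (((MeasurableEquiv.piCongrLeft (fun _ : Fin (a + b) => Y) finSumFinEquiv).symm.trans
        (MeasurableEquiv.sumPiEquivProdPi fun _ : Fin a ⊕ Fin b => Y)).symm (x, y) : Fin (a + b) → Y) = Fin.append x y := by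
  set e := ((MeasurableEquiv.piCongrLeft (fun _ : Fin (a + b) => Y) finSumFinEquiv).symm.trans
    (MeasurableEquiv.sumPiEquivProdPi fun _ : Fin a ⊕ Fin b => Y)) with he
  have h : e (Fin.append x y) = (x, y) := by
    refine Prod.ext (funext fun t => ?_) (funext fun j => ?_)
    · rw [he, Literature.Analysis.OperatorTheory.finSplit_apply_fst, Fin.append_left]
    · rw [he, Literature.Analysis.OperatorTheory.finSplit_apply_snd, Fin.append_right]
  rw [← h, MeasurableEquiv.symm_apply_apply]

/-- The inverse of `piFinSuccAbove … 0` is `Fin.cons`. -/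
theorem piFinSuccAbove_zero_symm_apply (k : ℕ) (p : Y × (Fin k → Y)) :
    (MeasurableEquiv.piFinSuccAbove (fun _ : Fin (k + 1) => Y) 0).symm p = Fin.cons p.1 p.2 := by
  simp only [MeasurableEquiv.piFinSuccAbove_symm_apply, Fin.insertNthEquiv, Fin.insertNth_zero, Equiv.coe_fn_mk]
  rfl

variable (Y) in
/-- The structural equivalence of the three peeled atoms (left atom outermost):
`(Fin ((e+1)+(n+2)+(e+1)) → Y) ≃ᵐ (Y × (Fin e → Y)) × ((Y × (Fin (n+1) → Y)) × (Y × (Fin e → Y)))`. -/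
theorem exists_atomSplit (e n : ℕ) (ν : Measure Y) [IsFiniteMeasure ν] :
    ∃ Ψ : (Fin (e + 1 + (n + 1 + 1) + (e + 1)) → Y) ≃ᵐ (Y × (Fin e → Y)) × ((Y × (Fin (n + 1) → Y)) × (Y × (Fin e → Y))),
      MeasurePreserving Ψ (Measure.pi fun _ => ν)
        ((ν.prod (Measure.pi fun _ => ν)).prod ((ν.prod (Measure.pi fun _ => ν)).prod (ν.prod (Measure.pi fun _ => ν)))) ∧
      ∀ (zu : Y) (L : Fin e → Y) (zd : Y) (W : Fin (n + 1) → Y) (z0 : Y) (R : Fin e → Y),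
        Ψ.symm ((zu, L), ((zd, W), (z0, R))) = atomApp (Fin.cons z0 R) (Fin.cons zd W) (Fin.cons zu L) := by
  -- the pieces
  set e1 := ((MeasurableEquiv.piCongrLeft (fun _ : Fin (e + 1 + (n + 1 + 1) + (e + 1)) => Y) finSumFinEquiv).symm.trans
    (MeasurableEquiv.sumPiEquivProdPi fun _ : Fin (e + 1 + (n + 1 + 1)) ⊕ Fin (e + 1) => Y)) with he1
  set e2 := ((MeasurableEquiv.piCongrLeft (fun _ : Fin (e + 1 + (n + 1 + 1)) => Y) finSumFinEquiv).symm.trans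
    (MeasurableEquiv.sumPiEquivProdPi fun _ : Fin (e + 1) ⊕ Fin (n + 1 + 1) => Y)) with he2
  set ce := MeasurableEquiv.piFinSuccAbove (fun _ : Fin (e + 1) => Y) 0 with hce
  set cn := MeasurableEquiv.piFinSuccAbove (fun _ : Fin (n + 1 + 1) => Y) 0 with hcn
  have h1 := Literature.Analysis.OperatorTheory.measurePreserving_finSplit (ρ := ν) (e + 1 + (n + 1 + 1)) (e + 1)
  have h2 := Literature.Analysis.OperatorTheory.measurePreserving_finSplit (ρ := ν) (e + 1) (n + 1 + 1)
  have hce' : MeasurePreserving ce (Measure.pi fun _ => ν) (ν.prod (Measure.pi fun _ : Fin e => ν)) :=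
    measurePreserving_piFinSuccAbove (fun _ : Fin (e + 1) => ν) 0
  have hcn' : MeasurePreserving cn (Measure.pi fun _ => ν) (ν.prod (Measure.pi fun _ : Fin (n + 1) => ν)) :=
    measurePreserving_piFinSuccAbove (fun _ : Fin (n + 1 + 1) => ν) 0
  -- inner: `(Fin ((e+1)+(n+2)) → Y) ≃ (A₁, A₂) ≃ (A₂, A₁) ≃ (cn A₂, ce A₁)`
  set inner := e2.trans (MeasurableEquiv.prodComm.trans (MeasurableEquiv.prodCongr cn ce)) with hinner
  have hinner' : MeasurePreserving inner (Measure.pi fun _ => ν)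
      ((ν.prod (Measure.pi fun _ : Fin (n + 1) => ν)).prod (ν.prod (Measure.pi fun _ : Fin e => ν))) :=
    (hcn'.prod hce').comp ((Measure.measurePreserving_swap).comp h2)
  -- outer: `(Fin N → Y) ≃ (A₁₂, A₃) ≃ (A₃, A₁₂) ≃ (ce A₃, inner A₁₂)`
  set Ψ := e1.trans (MeasurableEquiv.prodComm.trans (MeasurableEquiv.prodCongr ce inner)) with hΨ
  refine ⟨Ψ, (hce'.prod hinner').comp ((Measure.measurePreserving_swap).comp h1), fun zu L zd W z0 R => ?_⟩
  -- the forward map on an assembled configuration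
  have hfin1 : e1 (atomApp (Fin.cons z0 R) (Fin.cons zd W) (Fin.cons zu L)) =
      (Fin.append (Fin.cons z0 R) (Fin.cons zd W), Fin.cons zu L) := by
    refine Prod.ext (funext fun t => ?_) (funext fun j => ?_)
    · rw [he1, Literature.Analysis.OperatorTheory.finSplit_apply_fst]; unfold atomApp; rw [Fin.append_left]
    · rw [he1, Literature.Analysis.OperatorTheory.finSplit_apply_snd]; unfold atomApp; rw [Fin.append_right]
  have hfin2 : e2 (Fin.append (Fin.cons z0 R) (Fin.cons zd W)) = (Fin.cons z0 R, Fin.cons zd W) := by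
    refine Prod.ext (funext fun t => ?_) (funext fun j => ?_)
    · rw [he2, Literature.Analysis.OperatorTheory.finSplit_apply_fst, Fin.append_left]
    · rw [he2, Literature.Analysis.OperatorTheory.finSplit_apply_snd, Fin.append_right]
  have hc : ∀ (k : ℕ) (z : Y) (Z : Fin k → Y), MeasurableEquiv.piFinSuccAbove (fun _ : Fin (k + 1) => Y) 0 (Fin.cons z Z) = (z, Z) :=
    fun k z Z => by
      rw [← piFinSuccAbove_zero_symm_apply k (z, Z), MeasurableEquiv.apply_symm_apply]
  have hfwd : Ψ (atomApp (Fin.cons z0 R) (Fin.cons zd W) (Fin.cons zu L)) = ((zu, L), ((zd, W), (z0, R))) := by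
    rw [hΨ, MeasurableEquiv.trans_apply, MeasurableEquiv.trans_apply, hfin1]
    show (ce (Fin.cons zu L), inner (Fin.append (Fin.cons z0 R) (Fin.cons zd W))) = ((zu, L), ((zd, W), (z0, R)))
    rw [hinner, MeasurableEquiv.trans_apply, MeasurableEquiv.trans_apply, hfin2]
    show (ce (Fin.cons zu L), (cn (Fin.cons zd W), ce (Fin.cons z0 R))) = ((zu, L), ((zd, W), (z0, R)))
    rw [hce, hcn, hc, hc, hc]
  rw [← hfwd, MeasurableEquiv.symm_apply_apply]

end Structural

/-! ## §2 The inserted chain as an integral over the three peeled atoms -/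

section AtomIntegral

variable {S : ℕ} [NeZero S] {G : Type} [Group G] {Nc : ℕ} (ρ : G →* Matrix (Fin Nc) (Fin Nc) ℂ)
variable [TopologicalSpace G] [IsTopologicalGroup G] [CompactSpace G] [MeasurableSpace G] [BorelSpace G]
  [SecondCountableTopology G]

omit [NeZero S] [Group G] [TopologicalSpace G] [IsTopologicalGroup G] [CompactSpace G] [BorelSpace G] [SecondCountableTopology G] in
/-- The forward dressing is jointly measurable. -/
theorem measurable_readR {e : ℕ} {I : (Fin (e + 1) → HalfCfg S S G × HalfCfg S S G) → ℝ} (hIm : Measurable I) :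
    Measurable (uncurry (readR (S := S) (G := G) I)) := by
  unfold readR uncurry
  refine hIm.comp (measurable_pi_lambda _ fun j => ?_)
  exact ((measurable_pi_apply (X := fun _ : Fin (e + 1) => HalfCfg S S G) j).comp measurable_fst).prodMk
    (((measurable_pi_apply (X := fun _ : Fin (e + 2) => ℕ × HalfCfg S S G) j.succ).comp measurable_snd).snd)

omit [NeZero S] [Group G] [TopologicalSpace G] [IsTopologicalGroup G] [CompactSpace G] [BorelSpace G] [SecondCountableTopology G] in
/-- The reflected dressing is jointly measurable. -/
theorem measurable_readL {e : ℕ} {I : (Fin (e + 1) → HalfCfg S S G × HalfCfg S S G) → ℝ} (hIm : Measurable I) :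
    Measurable (uncurry (readL (S := S) (G := G) I)) := by
  unfold readL uncurry
  have hΘ : Measurable (thetaHalf : HalfCfg S S G → HalfCfg S S G) := by
    have h : (thetaHalf : HalfCfg S S G → HalfCfg S S G) = ⇑(thetaEquiv (S := S) (G := G)) :=
      funext fun Y => (thetaEquiv_apply Y).symm
    rw [h]; exact (thetaEquiv (S := S) (G := G)).measurable
  refine hIm.comp (measurable_pi_lambda _ fun j => ?_)
  exact (hΘ.comp ((measurable_pi_apply (X := fun _ : Fin (e + 1) => HalfCfg S S G) (Fin.rev j)).comp measurable_fst)).prodMk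
    (((measurable_pi_apply (X := fun _ : Fin (e + 2) => ℕ × HalfCfg S S G) (Fin.rev j).castSucc).comp measurable_snd).snd)

omit [SecondCountableTopology G] in
/-- ★ **The inserted link-kernel chain as an integral over the three peeled atoms.**  With `Pb = blockFun (readR I)`, `Qb = blockFun 1`,
`Lb = blockFun (readL I)` and the finite measure `ν = μ̃ ⊗ halfHaar` on the sites:
`∫ I(reflected read) I(forward read) ∏_s c dν^{⊗N}
   = ∫ Qb(z_d·₁, W, z_u) · (Lb(z_u·₁, L, z_0) · Pb(z_0·₁, R, z_d)) d[(ν⊗ν^e) ⊗ ((ν⊗ν^{n+1}) ⊗ (ν⊗ν^e))]((z_u,L),((z_d,W),(z_0,R)))`. -/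
theorem integral_insertedChain_eq_integral_atoms {β : ℝ} (hβ : 0 ≤ β) (M : ℝ) {e n : ℕ}
    [NeZero (e + 1 + (n + 1 + 1) + (e + 1))] (I : (Fin (e + 1) → HalfCfg S S G × HalfCfg S S G) → ℝ) :
    ∫ U : Fin (e + 1 + (n + 1 + 1) + (e + 1)) → (ℕ × HalfCfg S S G) × HalfCfg S S G,
        I (fun j : Fin (e + 1) =>
            (thetaHalf (U (1 - (((j : ℕ) : Fin (e + 1 + (n + 1 + 1) + (e + 1))) + 1))).2,
              ((U (-(((j : ℕ) : Fin (e + 1 + (n + 1 + 1) + (e + 1))) + 1))).1).2)) *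
          I (fun j : Fin (e + 1) =>
            ((U ((((j : ℕ) : Fin (e + 1 + (n + 1 + 1) + (e + 1))) + 1))).2,
              ((U (((j : ℕ) : Fin (e + 1 + (n + 1 + 1) + (e + 1))) + 1)).1).2)) *
          ∏ s, linkKer ρ β M (U s).1 (U (s + 1)).2 (U (s + 1)).1
        ∂(Measure.pi fun _ => (tMeasure S G Nc β M).prod (halfHaar S G)) =
      ∫ ω : (((ℕ × HalfCfg S S G) × HalfCfg S S G) × (Fin e → (ℕ × HalfCfg S S G) × HalfCfg S S G)) ×
          (((ℕ × HalfCfg S S G) × HalfCfg S S G) × (Fin (n + 1) → (ℕ × HalfCfg S S G) × HalfCfg S S G)) ×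
          (((ℕ × HalfCfg S S G) × HalfCfg S S G) × (Fin e → (ℕ × HalfCfg S S G) × HalfCfg S S G)),
        blockFun ρ β M (fun _ _ => (1 : ℝ)) ω.2.1.1.1 ω.2.1.2 ω.1.1 *
          (blockFun ρ β M (readL I) ω.1.1.1 ω.1.2 ω.2.2.1 * blockFun ρ β M (readR I) ω.2.2.1.1 ω.2.2.2 ω.2.1.1)
        ∂((((tMeasure S G Nc β M).prod (halfHaar S G)).prod (Measure.pi fun _ => (tMeasure S G Nc β M).prod (halfHaar S G))).prod
          ((((tMeasure S G Nc β M).prod (halfHaar S G)).prod (Measure.pi fun _ => (tMeasure S G Nc β M).prod (halfHaar S G))).prod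
            (((tMeasure S G Nc β M).prod (halfHaar S G)).prod (Measure.pi fun _ => (tMeasure S G Nc β M).prod (halfHaar S G))))) := by
  haveI := isFiniteMeasure_tMeasure (S := S) (G := G) (Nc := Nc) hβ M
  haveI : IsProbabilityMeasure (halfHaar S G) := by unfold halfHaar; infer_instance
  obtain ⟨Ψ, hΨ, hΨsymm⟩ := exists_atomSplit ((ℕ × HalfCfg S S G) × HalfCfg S S G) e n ((tMeasure S G Nc β M).prod (halfHaar S G))
  rw [← (hΨ.symm _).integral_comp' (f := Ψ.symm)]
  refine integral_congr_ae (ae_of_all _ fun ω => ?_)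
  rcases ω with ⟨⟨zu, L⟩, ⟨⟨zd, W⟩, ⟨z0, R⟩⟩⟩
  dsimp only
  rw [hΨsymm, insertedChain_atomApp]
  simp only [Fin.cons_zero, Fin.tail_cons]
  ring

end AtomIntegral

end Summit.QuantumFields.YangMills.Cruxes.DiagonalMirrorRPR.SignTwistedDiagonalTrace.WilsonDiagonal

end
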